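import Mathlib
import Summits.Ventures.PercRepro2.Defs

/-!
# Coin systems: directed reachability, the two clusters and the one-arc gate (blind cell
PercRepro2, night-2)

A COIN SYSTEM on the vertex type `V` is a coin type `E` with an arc map `arcs : E → Finset (V × V)`;
the coins are independent (`Config E`, `weight`, `expect`, `prob` of `Defs.lean`) and every arc of an
open coin is open.  A digraph is the case of one arc per coin, an undirected graph the case of
antiparallel pairs; `IsMixed` is the class «single arcs and antiparallel pairs» — the scope of row
2′DARC (proofs/NIGHT2-DARC.md §1; `CoinScope.lean` shows that general arc sets break the BASE row).

Vocabulary (CHECKPOINT §1 «coin systems and the one-arc form», MINEC-GATE.md §8):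
* `Reach arcs ω x y` — `x ⇝ y` along open arcs; `fwdEvent arcs s v = {v ∈ S⁺}` (forward cluster of
  `s`), `bwdEvent arcs v T = {v ∈ K⁻}` (backward cluster of `T`), `avoidEvent arcs s T = R_T = {s ↛ T}`;
* `ReachPlus arcs ω u w` — reachability in `D + (u → w)` (one deterministic arc added);
  `gateEvent arcs s T u w = {s ↛ T in D + (u → w)}`, `pivotalEvent = {u ∈ S⁺, w ∈ K⁻} ∩ R_T`;
* the ONE-ARC LEMMA `reachPlus_iff`: `x ⇝ y in D + (u→w)` iff `x ⇝ y` or (`x ⇝ u` and `w ⇝ y`),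
  hence the UNION FORM `gateEvent_eq_union`: the gate event is `{S⁺ avoids u} ∪ {K⁻ avoids w}` inside
  `R_T` — an S-avoidance event (Lemma A) joined with a K-avoidance event (Lemma A′);
* the centred functional in cleared form: `phiC p arcs s T a b 𝒟 = P(R)²·Φ(𝒟)` with
  `Φ(𝒟) = E[(X − m_X)(Y − m_Y); 𝒟]`, `X = 1[a ∈ S⁺]`, `Y = 1[b ∈ S⁺]`, `m = E[· | R_T]`;
  `DARC` (row 2′DARC: `Φ(gate) ≥ 0`), `PAGate` (`Cov(X,Y | gate) ≥ 0`, MINEC-GATE §6) and the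
  night-2 strengthening `QR` (`P(R)·Cov(X,Y | R) ≥ P(Q)·Cov(X,Y | Q)`, `Q` = pivotal) as Props;
* the EXACT IDENTITY `phiC_gate_eq`: `P(R)²·Φ(gate) = P(R)·[P(E)E[XY;E] − E[X;E]E[Y;E]] + (QR-slack)`,
  so `DARC ⟸ PAGate ∧ QR` (`darc_of_pa_qr`) and `QR ⟺ Φ(E) ≥ P(E)²·Cov(X,Y|E)/P(R)`.
Nothing about BHK is proved here; this is the vocabulary and the finite-sum algebra of the line.
-/

namespace Summit.Ventures.PercRepro2.Coin

section Reach

variable {V : Type*} {E : Type*}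

/-- Open arc relation: some open coin of `ω` carries the arc `(x, y)`. -/
def OpenArc (arcs : E → Finset (V × V)) (ω : Config E) (x y : V) : Prop :=
  ∃ e, ω e = true ∧ (x, y) ∈ arcs e

/-- Directed reachability `x ⇝ y` along the open arcs of `ω`. -/
def Reach (arcs : E → Finset (V × V)) (ω : Config E) : V → V → Prop :=
  Relation.ReflTransGen (OpenArc arcs ω)

/-- `x ⇝ x`. -/
lemma reach_refl (arcs : E → Finset (V × V)) (ω : Config E) (x : V) : Reach arcs ω x x :=
  Relation.ReflTransGen.refl

/-- Transitivity of reachability. -/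
lemma reach_trans {arcs : E → Finset (V × V)} {ω : Config E} {x y z : V}
    (h₁ : Reach arcs ω x y) (h₂ : Reach arcs ω y z) : Reach arcs ω x z :=
  Relation.ReflTransGen.trans h₁ h₂

/-- An open arc gives reachability. -/
lemma reach_of_openArc {arcs : E → Finset (V × V)} {ω : Config E} {x y : V}
    (h : OpenArc arcs ω x y) : Reach arcs ω x y :=
  Relation.ReflTransGen.single h

/-- An open arc stays open in a larger configuration. -/
lemma openArc_mono {arcs : E → Finset (V × V)} {ω ω' : Config E} (h : ω ≤ ω') {x y : V}
    (hxy : OpenArc arcs ω x y) : OpenArc arcs ω' x y := by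
  obtain ⟨e, he, hpq⟩ := hxy
  refine ⟨e, ?_, hpq⟩
  have := h e
  rw [he] at this
  exact Bool.le_iff_imp.1 this rfl

/-- Reachability is monotone in the configuration. -/
lemma reach_mono {arcs : E → Finset (V × V)} {ω ω' : Config E} (h : ω ≤ ω') {x y : V}
    (hxy : Reach arcs ω x y) : Reach arcs ω' x y := by
  induction hxy with
  | refl => exact reach_refl arcs ω' x
  | tail _ hstep ih => exact reach_trans ih (reach_of_openArc (openArc_mono h hstep))

/-- A MIXED coin system: every coin is a single arc or an antiparallel pair (digraphs, undirected and
mixed graphs) — the scope of row 2′DARC. -/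
def IsMixed [DecidableEq V] (arcs : E → Finset (V × V)) : Prop :=
  ∀ e, (∃ x y, arcs e = {(x, y)}) ∨ (∃ x y, arcs e = {(x, y), (y, x)})

/-- Reachability in `D + (u → w)`: the open arcs of `ω` together with the deterministic arc `u → w`. -/
def ReachPlus (arcs : E → Finset (V × V)) (ω : Config E) (u w : V) : V → V → Prop :=
  Relation.ReflTransGen (fun x y => OpenArc arcs ω x y ∨ (x = u ∧ y = w))

/-- **The one-arc lemma.** `x ⇝ y` in `D + (u → w)` iff `x ⇝ y` in `D`, or `x ⇝ u` and `w ⇝ y` in `D`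
(a path through the added arc is cut at its first use). -/
theorem reachPlus_iff (arcs : E → Finset (V × V)) (ω : Config E) (u w x y : V) :
    ReachPlus arcs ω u w x y ↔
      Reach arcs ω x y ∨ (Reach arcs ω x u ∧ Reach arcs ω w y) := by
  constructor
  · intro h
    induction h with
    | refl => exact Or.inl (reach_refl arcs ω x)
    | tail _ hstep ih =>
      rename_i y' z
      rcases hstep with harc | ⟨rfl, rfl⟩
      · rcases ih with h₁ | ⟨h₁, h₂⟩
        · exact Or.inl (reach_trans h₁ (reach_of_openArc harc))
        · exact Or.inr ⟨h₁, reach_trans h₂ (reach_of_openArc harc)⟩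
      · rcases ih with h₁ | ⟨h₁, _⟩
        · exact Or.inr ⟨h₁, reach_refl arcs ω _⟩
        · exact Or.inr ⟨h₁, reach_refl arcs ω _⟩
  · have lift : ∀ {p q : V}, Reach arcs ω p q → ReachPlus arcs ω u w p q := by
      intro p q hpq
      induction hpq with
      | refl => exact Relation.ReflTransGen.refl
      | tail _ hstep ih => exact Relation.ReflTransGen.tail ih (Or.inl hstep)
    rintro (h | ⟨h₁, h₂⟩)
    · exact lift h
    · exact Relation.ReflTransGen.trans (lift h₁)
        (Relation.ReflTransGen.trans (Relation.ReflTransGen.single (Or.inr ⟨rfl, rfl⟩)) (lift h₂))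

end Reach

section Events

variable {V : Type*} {E : Type*}

/-- `{v ∈ S⁺}`: `v` is reachable from the root `s`. -/
def fwdEvent (arcs : E → Finset (V × V)) (s v : V) : Set (Config E) := {ω | Reach arcs ω s v}

/-- `{v ∈ K⁻}`: `v` reaches the target set `T`. -/
def bwdEvent (arcs : E → Finset (V × V)) (v : V) (T : Finset V) : Set (Config E) :=
  {ω | ∃ t ∈ T, Reach arcs ω v t}

/-- `R_T = {s ↛ T}`: the root avoids the target set. -/
def avoidEvent (arcs : E → Finset (V × V)) (s : V) (T : Finset V) : Set (Config E) :=
  {ω | ∀ t ∈ T, ¬ Reach arcs ω s t}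

/-- The GATE event of the arc `u → w`: `{s ↛ T in D + (u → w)}`. -/
def gateEvent (arcs : E → Finset (V × V)) (s : V) (T : Finset V) (u w : V) : Set (Config E) :=
  {ω | ∀ t ∈ T, ¬ ReachPlus arcs ω u w s t}

/-- The PIVOTAL event of the arc `u → w`: `{u ∈ S⁺, w ∈ K⁻} ∩ R_T` (adding the arc connects `s` to `T`). -/
def pivotalEvent (arcs : E → Finset (V × V)) (s : V) (T : Finset V) (u w : V) : Set (Config E) :=
  avoidEvent arcs s T ∩ fwdEvent arcs s u ∩ bwdEvent arcs w T

/-- Forward-cluster events are increasing. -/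
lemma isUpperSet_fwdEvent (arcs : E → Finset (V × V)) (s v : V) : IsUpperSet (fwdEvent arcs s v) :=
  fun _ _ h hω => reach_mono h hω

/-- Backward-cluster events are increasing. -/
lemma isUpperSet_bwdEvent (arcs : E → Finset (V × V)) (v : V) (T : Finset V) :
    IsUpperSet (bwdEvent arcs v T) :=
  fun _ _ h ⟨t, ht, hω⟩ => ⟨t, ht, reach_mono h hω⟩

/-- Avoidance events are decreasing. -/
lemma isLowerSet_avoidEvent (arcs : E → Finset (V × V)) (s : V) (T : Finset V) :
    IsLowerSet (avoidEvent arcs s T) :=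
  fun _ _ h hω t ht hr => hω t ht (reach_mono h hr)

/-- **The union form of the gate.** Inside `R_T`, `{s ↛ T in D + (u → w)}` is the union of the
S-avoidance event `{u ∉ S⁺}` and the K-avoidance event `{w ∉ K⁻}`. -/
theorem gateEvent_eq_union (arcs : E → Finset (V × V)) (s : V) (T : Finset V) (u w : V) :
    gateEvent arcs s T u w =
      avoidEvent arcs s T ∩ ((fwdEvent arcs s u)ᶜ ∪ (bwdEvent arcs w T)ᶜ) := by
  ext ω
  simp only [gateEvent, avoidEvent, fwdEvent, bwdEvent, Set.mem_setOf_eq, Set.mem_inter_iff,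
    Set.mem_union, Set.mem_compl_iff, reachPlus_iff]
  constructor
  · intro h
    refine ⟨fun t ht hr => h t ht (Or.inl hr), ?_⟩
    by_contra hcon
    obtain ⟨h₁, h₂⟩ := not_or.mp hcon
    have hsu := not_not.mp h₁
    obtain ⟨t, ht, hwt⟩ := not_not.mp h₂
    exact h t ht (Or.inr ⟨hsu, hwt⟩)
  · rintro ⟨hR, hor⟩ t ht (hr | ⟨hsu, hwt⟩)
    · exact hR t ht hr
    · rcases hor with hu | hw
      · exact hu hsu
      · exact hw ⟨t, ht, hwt⟩

/-- The gate event is `R_T` minus the pivotal event. -/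
theorem gateEvent_eq_diff (arcs : E → Finset (V × V)) (s : V) (T : Finset V) (u w : V) :
    gateEvent arcs s T u w = avoidEvent arcs s T \ pivotalEvent arcs s T u w := by
  rw [gateEvent_eq_union]
  ext ω
  simp only [pivotalEvent, Set.mem_inter_iff, Set.mem_union, Set.mem_compl_iff, Set.mem_sdiff]
  tauto

/-- The gate event and the pivotal event partition `R_T`. -/
theorem avoidEvent_eq_gate_union_pivotal (arcs : E → Finset (V × V)) (s : V) (T : Finset V)
    (u w : V) :
    avoidEvent arcs s T = gateEvent arcs s T u w ∪ pivotalEvent arcs s T u w := by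
  rw [gateEvent_eq_diff]
  ext ω
  simp only [pivotalEvent, Set.mem_union, Set.mem_sdiff, Set.mem_inter_iff]
  tauto

/-- The gate event and the pivotal event are disjoint. -/
theorem disjoint_gate_pivotal (arcs : E → Finset (V × V)) (s : V) (T : Finset V) (u w : V) :
    Disjoint (gateEvent arcs s T u w) (pivotalEvent arcs s T u w) := by
  rw [gateEvent_eq_diff]
  exact Set.disjoint_sdiff_left

end Events

section Functional

open Classical

variable {V : Type*} {E : Type*} [Fintype E] [DecidableEq E]
  {R : Type*} [CommRing R]

/-- `E[f; 𝒟]`: the expectation of `f` restricted to the event `𝒟`. -/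
noncomputable def massE (p : E → R) (f : Config E → R) (D : Set (Config E)) : R :=
  expect p (D.indicator f)

/-- The marker indicator `X = 1[a ∈ S⁺]`. -/
noncomputable def marker (arcs : E → Finset (V × V)) (s a : V) : Config E → R :=
  fun ω => if Reach arcs ω s a then 1 else 0

/-- `E[f; 𝒟₁ ∪ 𝒟₂] = E[f; 𝒟₁] + E[f; 𝒟₂]` for disjoint events. -/
lemma massE_union_of_disjoint (p : E → R) (f : Config E → R) {D₁ D₂ : Set (Config E)}
    (h : Disjoint D₁ D₂) : massE p f (D₁ ∪ D₂) = massE p f D₁ + massE p f D₂ := by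
  unfold massE
  rw [Set.indicator_union_of_disjoint h]
  exact expect_add p (D₁.indicator f) (D₂.indicator f)

/-- `P(𝒟) = E[1; 𝒟]`. -/
lemma prob_eq_massE_one (p : E → R) (D : Set (Config E)) : prob p D = massE p (fun _ => 1) D := by
  unfold massE expect prob
  refine Finset.sum_congr rfl fun ω _ => ?_
  by_cases hω : ω ∈ D <;> simp [hω]

/-- The CLEARED centred functional `P(R)² · Φ(𝒟)` with
`Φ(𝒟) = E[(X − m_X)(Y − m_Y); 𝒟]`, `m = E[· | R_T]` (no division): writing `P = P(R_T)`,
`A = E[X; R_T]`, `B = E[Y; R_T]`,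
`phiC 𝒟 = P²·E[XY; 𝒟] − P·A·E[Y; 𝒟] − P·B·E[X; 𝒟] + A·B·P(𝒟)`. -/
noncomputable def phiC (p : E → R) (arcs : E → Finset (V × V)) (s : V) (T : Finset V) (a b : V)
    (D : Set (Config E)) : R :=
  let X := marker (R := R) arcs s a
  let Y := marker (R := R) arcs s b
  let RT := avoidEvent arcs s T
  prob p RT ^ 2 * massE p (fun ω => X ω * Y ω) D
    - prob p RT * massE p X RT * massE p Y D
    - prob p RT * massE p Y RT * massE p X D
    + massE p X RT * massE p Y RT * prob p D

/-- The cleared BHK/Harris form `P(𝒟)·E[XY; 𝒟] − E[X; 𝒟]·E[Y; 𝒟]` (`= P(𝒟)²·Cov(X, Y | 𝒟)`). -/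
noncomputable def covC (p : E → R) (arcs : E → Finset (V × V)) (s a b : V) (D : Set (Config E)) : R :=
  let X := marker (R := R) arcs s a
  let Y := marker (R := R) arcs s b
  prob p D * massE p (fun ω => X ω * Y ω) D - massE p X D * massE p Y D

/-- **Row 2′DARC** (cleared form): `Φ(s ↛ T in D + (u → w)) ≥ 0`. -/
def DARC [LinearOrder R] (p : E → R) (arcs : E → Finset (V × V)) (s : V) (T : Finset V) (a b u w : V) :
    Prop :=
  0 ≤ phiC p arcs s T a b (gateEvent arcs s T u w)

/-- **(PA-gate)** (cleared form): `Cov(X, Y | gate event) ≥ 0` — MINEC-GATE.md §6. -/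
def PAGate [LinearOrder R] (p : E → R) (arcs : E → Finset (V × V)) (s : V) (T : Finset V)
    (a b u w : V) : Prop :=
  0 ≤ covC p arcs s a b (gateEvent arcs s T u w)

/-- **(QR)** (night-2, cleared form): `P(R)·Cov(X, Y | R) ≥ P(Q)·Cov(X, Y | Q)`, `Q` the pivotal
event, i.e. `P(Q)·covC(R) − P(R)·covC(Q) ≥ 0`. -/
def QR [LinearOrder R] (p : E → R) (arcs : E → Finset (V × V)) (s : V) (T : Finset V) (a b u w : V) :
    Prop :=
  0 ≤ prob p (pivotalEvent arcs s T u w) * covC p arcs s a b (avoidEvent arcs s T)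
      - prob p (avoidEvent arcs s T) * covC p arcs s a b (pivotalEvent arcs s T u w)

/-- **The exact identity behind the line**: with `𝓔` the gate event and `Q` the pivotal event,
`P(R)²·Φ(𝓔) = P(R)·[P(𝓔)E[XY;𝓔] − E[X;𝓔]E[Y;𝓔]] + [P(Q)·covC(R) − P(R)·covC(Q)]`,
i.e. `phiC(gate) = P(R)·covC(gate) + (QR-slack)`. -/
theorem phiC_gate_eq (p : E → R) (arcs : E → Finset (V × V)) (s : V) (T : Finset V) (a b u w : V) :
    phiC p arcs s T a b (gateEvent arcs s T u w) =
      prob p (avoidEvent arcs s T) * covC p arcs s a b (gateEvent arcs s T u w)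
        + (prob p (pivotalEvent arcs s T u w) * covC p arcs s a b (avoidEvent arcs s T)
            - prob p (avoidEvent arcs s T) * covC p arcs s a b (pivotalEvent arcs s T u w)) := by
  have hsplit := avoidEvent_eq_gate_union_pivotal arcs s T u w
  have hdisj := disjoint_gate_pivotal arcs s T u w
  -- masses over R_T split over the gate and the pivotal event
  have hP : prob p (avoidEvent arcs s T) =
      prob p (gateEvent arcs s T u w) + prob p (pivotalEvent arcs s T u w) := by
    rw [hsplit, prob_union_of_disjoint p hdisj]
  have hm : ∀ f : Config E → R, massE p f (avoidEvent arcs s T) =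
      massE p f (gateEvent arcs s T u w) + massE p f (pivotalEvent arcs s T u w) := by
    intro f
    rw [hsplit, massE_union_of_disjoint p f hdisj]
  simp only [phiC, covC]
  rw [hP, hm (marker arcs s a), hm (marker arcs s b),
    hm (fun ω => marker arcs s a ω * marker arcs s b ω)]
  ring

/-- **`DARC ⟸ PAGate ∧ QR`**: on any coin system the one-arc gate statement follows from the
(PA-gate) covariance positivity and the night-2 strengthening (QR), by the identity `phiC_gate_eq`
(needs `P(R_T) ≥ 0`, which holds for probability weights). -/
theorem darc_of_pa_qr [LinearOrder R] [IsStrictOrderedRing R] (p : E → R) (arcs : E → Finset (V × V))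
    (s : V) (T : Finset V) (a b u w : V) (hR : 0 ≤ prob p (avoidEvent arcs s T))
    (hPA : PAGate p arcs s T a b u w) (hQR : QR p arcs s T a b u w) :
    DARC p arcs s T a b u w := by
  unfold DARC
  rw [phiC_gate_eq]
  unfold PAGate at hPA
  unfold QR at hQR
  have := mul_nonneg hR hPA
  linarith

/-- **`QR ⟺ Φ(gate) ≥ P(R)·covC(gate)`**: the strengthening (QR) says exactly that the gate functional
dominates `P(R)`-times the (PA-gate) slack, i.e. `Φ(𝓔) ≥ P(𝓔)²·Cov(X, Y | 𝓔) / P(R)`. -/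
theorem qr_iff [LinearOrder R] [IsStrictOrderedRing R] (p : E → R) (arcs : E → Finset (V × V))
    (s : V) (T : Finset V) (a b u w : V) :
    QR p arcs s T a b u w ↔
      prob p (avoidEvent arcs s T) * covC p arcs s a b (gateEvent arcs s T u w) ≤
        phiC p arcs s T a b (gateEvent arcs s T u w) := by
  unfold QR
  rw [phiC_gate_eq]
  constructor <;> intro h <;> linarith

end Functional

end Summit.Ventures.PercRepro2.Coin
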